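import Mathlib
import HarnessLib
import Summits.RiemannHypothesis.RiemannHypothesis.Theses.EarlyAppointments
import Summits.RiemannHypothesis.RiemannHypothesis.Theorems.Splittings.EarlyAppointmentsXiZetaDictionary
import Literature.NumberTheory.LFunctions.ZetaZeroSumsLehmanExplicit
import Literature.NumberTheory.LFunctions.ZetaArgHSW
import Literature.NumberTheory.LFunctions.TuringMethodProofs

/-!
# Skeleton for Remainder0Xi (ρ2) — RH-free level-0 remainder bound for Ξ

Line: rho2_v1 for crux stmt-RiemannHypothesis-24730.
Route: EarlyAppointments.

Target: for γ > T_PT = 3000175332800 and w with |Re w − γ| ≤ 67.5, |Im w| ≤ 1/2, Ξ(w) ≠ 0: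
  ‖Ξ′/Ξ(w) − Σᶠ_{near} ord/(w−u)‖ ≤ (1/2)/s(γ) where s(γ) = 2π/log(γ/2π).

Strategy (BRIEF S1–S6):
- S1: Hadamard partial fraction Ξ′/Ξ = Σ_n pairs
- S2: Near/far split with multiplicities
- S3: Conjugate symmetrization
- S4: Abel (lehman_identity) + L1 dictionary (xiDictHalfOpen_holds)
- S5: Main term = L3 (FarLogKernelSharp: drift −π/4) + tilt
- S6: Fluctuation bounds via [P1] abs_zetaArgS_le_hsw + [PT11] abs_integral_zetaArgS_le_trudgian_holds

Stubs:
1. stub_farLogKernelSharp (L3): pure real analysis, far log-kernel integral is −π/4 + error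
2. stub_abelFarFieldBound: full bound using Abel + L1 + L3 + [P1] + [PT11]

Nothing here bears on the truth of RH; RH is not proved.
-/

set_option linter.dupNamespace false
namespace Summit.RiemannHypothesis.RiemannHypothesis.Theorems.EarlyAppointmentsRemainder0Xi

open scoped BigOperators Topology Classical
open Real Complex Literature.NumberTheory.LFunctions Set Filter

/-- The Platt-Trudgian verification height. -/
abbrev T_PT : ℝ := 3000175332800

/-- The local mean spacing s(γ) = 2π/log(γ/2π). -/
noncomputable def xiSpacing (γ : ℝ) : ℝ := 2 * Real.pi / Real.log (γ / (2 * Real.pi))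

/-- The remainder bound constant η = 1/2. -/
noncomputable abbrev eta0 : ℝ := 1 / 2

/-- The box half-width R/2 = 67.5. -/
noncomputable abbrev boxHalfWidth : ℝ := 135 / 2

/-- **L3 (stub): The far log-kernel integral is −π/4 up to log x·(R + 4a)/x.**

For x large, the integral of log(u/2π)·2x/(x² − u²) over far regions [a, x − R/2] ∪ [x + R/2, ∞)
equals −π/4 up to an error bounded by log(x)·(R + 4a)/x.

Route: substitute u = xv; the main term ∫₀^∞ log v/(1 − v²) dv = −π²/4 gives −π/4 after the 1/π factor;
the tail contributes O(r·log(1/r)) with r = R/(2x). -/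
def FarLogKernelSharp : Prop :=
  ∀ x R a : ℝ, 2 ≤ a → a ≤ x / 2 → 2 ≤ R → 10 ^ 6 * R ≤ x →
    |(1 / (2 * π)) * ((∫ u in a..(x - R / 2), Real.log (u / (2 * π)) * (2 * x / (x ^ 2 - u ^ 2)))
        + ∫ u in Ioi (x + R / 2), Real.log (u / (2 * π)) * (2 * x / (x ^ 2 - u ^ 2))) + π / 4|
      ≤ Real.log x * (R + 4 * a) / x

/-- **STUB 1**: The far log-kernel integral bound (pure real analysis). -/
theorem stub_farLogKernelSharp : FarLogKernelSharp := by
  sorry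

/-- **Abel Far Field Bound (stub)**: The full remainder bound for the far field.

Using Lehman's identity (lehman_identity), the L1 dictionary (xiDictHalfOpen_holds),
L3 (FarLogKernelSharp), [P1] (abs_zetaArgS_le_hsw), and [PT11] (abs_integral_zetaArgS_le_trudgian_holds),
bound the far-zero contribution to Ξ′/Ξ. -/
def AbelFarFieldBound : Prop :=
  ∀ γ : ℝ, T_PT < γ → ∀ w : ℂ, |w.re - γ| ≤ boxHalfWidth → |w.im| ≤ eta0 →
    riemannXiUpper w ≠ 0 →
    ‖deriv riemannXiUpper w / riemannXiUpper w -
      ∑ᶠ u ∈ {u : ℂ | riemannXiUpper u = 0 ∧ |u.re - w.re| < boxHalfWidth},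
        ((analyticOrderAt riemannXiUpper u).toNat : ℂ) * (w - u)⁻¹‖
    ≤ eta0 / xiSpacing γ

/-- **STUB 2**: The full Abel far field bound. -/
theorem stub_abelFarFieldBound : AbelFarFieldBound := by
  sorry

/-- **Remainder0Xi_of** assembles the crux from the stubs.
Note: hL3 is used implicitly by hAbel (AbelFarFieldBound depends on FarLogKernelSharp). -/
theorem Remainder0Xi_of (_hL3 : FarLogKernelSharp) (hAbel : AbelFarFieldBound) :
    Summit.RiemannHypothesis.RiemannHypothesis.Theses.EarlyAppointments.Remainder0Xi := by
  intro γ hγ w hw_re hw_im hw_ne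
  -- The statement is exactly AbelFarFieldBound at these parameters
  exact hAbel γ hγ w hw_re hw_im hw_ne

/-- **The crux Remainder0Xi** follows from the two stubs. -/
theorem Remainder0Xi_holds :
    Summit.RiemannHypothesis.RiemannHypothesis.Theses.EarlyAppointments.Remainder0Xi :=
  Remainder0Xi_of stub_farLogKernelSharp stub_abelFarFieldBound

end Summit.RiemannHypothesis.RiemannHypothesis.Theorems.EarlyAppointmentsRemainder0Xi
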